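import Summits.Ventures.HodgeRepro2.T5SU11SphericalDecayAsymptotic
import Summits.Ventures.HodgeRepro2.T5SU11KernelSemiSeparable

/-!
# The diagonal Green's function at infinity: `K_λ(t, t) sinh 2t → −1/(2(λ − 1))`, and the resolvent is not trace class

On the diagonal `K_λ(t, t) = −φ_λ(a_t) χ_λ(t)`, and the two asymptotics `e^{(2−λ)t} φ_λ(a_t) → c(2 − λ)` (row 3xx) and
`e^{λt} χ_λ(t) → 1/((λ − 1) c(2 − λ))` (row 4xx) combine with `e^{−2t} sinh 2t → 1/2` into

  **`K_λ(t, t) sinh 2t → −1/(2(λ − 1))`** (`tendsto_kernel_diagonal_mul_sinh`):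

the diagonal Green's function times the radial volume density has a NON-ZERO limit at infinity — the `c`-function cancels.
Consequently

* `tendsto_kernel_diagonal_atTop` — `K_λ(t, t) → 0` as `t → ∞`;
* `not_integrableOn_kernel_diagonal_mul_sinh` — **`∫_0^∞ K_λ(t, t) sinh 2t dt` diverges: the resolvent `(L − μ)⁻¹` is not
  trace class** (its kernel's diagonal is not integrable against the volume density), the expected signature of the purely
  continuous spectrum of the radial Laplacian on `(0, ∞)`.

Nothing is claimed about (N).

Blind lane: Mathlib + the HodgeRepro2 prefix only; no sorry; axioms ⊆ {propext, Classical.choice,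
Quot.sound}.
-/

namespace Summit.Ventures.HodgeRepro2.T5SU11KernelDiagonalAsymptotic

open Filter Topology MeasureTheory
open Set (Ioi Ioc)
open T5SU11Cartan T5SU11SphericalFunction T5SU11SphericalBounds T5SU11SphericalAsymptotic T5SU11SphericalCfun
  T5SU11SphericalDecay T5SU11SphericalDecayAsymptotic T5SU11RadialGreenKernel T5SU11RadialGreenPositivity

/-- `e^{−2t} sinh 2t → 1/2` as `t → ∞`. -/
theorem tendsto_exp_neg_mul_sinh : Tendsto (fun t : ℝ => Real.exp (-(2 * t)) * Real.sinh (2 * t)) atTop (𝓝 (1 / 2)) := by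
  have h4 : Tendsto (fun t : ℝ => Real.exp (-(4 * t))) atTop (𝓝 0) :=
    Real.tendsto_exp_neg_atTop_nhds_zero.comp (tendsto_id.const_mul_atTop (by norm_num : (0 : ℝ) < 4))
  have h : Tendsto (fun t : ℝ => (1 - Real.exp (-(4 * t))) / 2) atTop (𝓝 ((1 - 0) / 2)) :=
    (tendsto_const_nhds.sub h4).div_const 2
  rw [sub_zero] at h
  refine h.congr' (Eventually.of_forall fun t => ?_)
  dsimp only
  rw [Real.sinh_eq]
  have e : Real.exp (-(2 * t)) * Real.exp (2 * t) = 1 := by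
    rw [← Real.exp_add]
    simp
  have e2 : Real.exp (-(2 * t)) * Real.exp (-(2 * t)) = Real.exp (-(4 * t)) := by
    rw [← Real.exp_add]
    ring_nf
  calc (1 - Real.exp (-(4 * t))) / 2
      = (Real.exp (-(2 * t)) * Real.exp (2 * t) - Real.exp (-(2 * t)) * Real.exp (-(2 * t))) / 2 := by rw [e, e2]
    _ = Real.exp (-(2 * t)) * ((Real.exp (2 * t) - Real.exp (-(2 * t))) / 2) := by ring

section measure

variable [MeasurableSpace Circle] [BorelSpace Circle]

variable {lam : ℝ} (hlam : 1 < lam)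

include hlam in
/-- **`K_λ(t, t) sinh 2t → −1/(2(λ − 1))`** as `t → ∞`. -/
theorem tendsto_kernel_diagonal_mul_sinh :
    Tendsto (fun t => sphGreenKernel lam t t * Real.sinh (2 * t)) atTop (𝓝 (-(1 / (2 * (lam - 1))))) := by
  have hc : 0 < cfun (2 - lam) := cfun_pos (by linarith)
  have h := (((tendsto_exp_two_sub_mul_sph_hyp hlam).mul (tendsto_exp_mul_sphDecay hlam)).mul
    tendsto_exp_neg_mul_sinh).neg
  have hval : -(cfun (2 - lam) * (1 / ((lam - 1) * cfun (2 - lam))) * (1 / 2)) = -(1 / (2 * (lam - 1))) := by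
    have : lam - 1 ≠ 0 := by linarith
    field_simp
  rw [hval] at h
  refine h.congr' (Eventually.of_forall fun t => ?_)
  dsimp only
  unfold sphGreenKernel greenKernel
  rw [min_self, max_self]
  have e : Real.exp ((2 - lam) * t) * Real.exp (lam * t) * Real.exp (-(2 * t)) = 1 := by
    rw [← Real.exp_add, ← Real.exp_add]
    ring_nf
    exact Real.exp_zero
  calc -(Real.exp ((2 - lam) * t) * sph lam (hyp t) * (Real.exp (lam * t) * sphDecay lam t)
        * (Real.exp (-(2 * t)) * Real.sinh (2 * t)))
      = -((Real.exp ((2 - lam) * t) * Real.exp (lam * t) * Real.exp (-(2 * t)))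
        * (sph lam (hyp t) * sphDecay lam t * Real.sinh (2 * t))) := by ring
    _ = -(sph lam (hyp t) * sphDecay lam t) * Real.sinh (2 * t) := by rw [e]; ring

include hlam in
/-- **`K_λ(t, t) → 0`** as `t → ∞`. -/
theorem tendsto_kernel_diagonal_atTop : Tendsto (fun t => sphGreenKernel lam t t) atTop (𝓝 0) := by
  have h1 := tendsto_kernel_diagonal_mul_sinh hlam
  have h2 : Tendsto (fun t : ℝ => (Real.sinh (2 * t))⁻¹) atTop (𝓝 0) := by
    have hexp : Tendsto (fun t : ℝ => Real.exp (2 * t) / 4) atTop atTop :=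
      (Real.tendsto_exp_atTop.comp (tendsto_id.const_mul_atTop (by norm_num : (0 : ℝ) < 2))).atTop_div_const
        (by norm_num)
    have : Tendsto (fun t : ℝ => Real.sinh (2 * t)) atTop atTop := by
      refine tendsto_atTop_mono' atTop ?_ hexp
      filter_upwards [eventually_ge_atTop (1 / 2 : ℝ)] with t ht
      exact exp_div_four_le_sinh (by linarith)
    exact this.inv_tendsto_atTop
  have h := h1.mul h2
  rw [mul_zero] at h
  refine h.congr' ?_
  filter_upwards [eventually_gt_atTop 0] with t ht
  have hs : Real.sinh (2 * t) ≠ 0 := (T5SU11ReductionOfOrder.sinh_two_mul_pos ht).ne'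
  field_simp

include hlam in
/-- **THE RESOLVENT IS NOT TRACE CLASS**: `K_λ(t, t) sinh 2t` is not integrable on `(0, ∞)` — its limit at infinity is the
non-zero constant `−1/(2(λ − 1))`. -/
theorem not_integrableOn_kernel_diagonal_mul_sinh :
    ¬ IntegrableOn (fun t => sphGreenKernel lam t t * Real.sinh (2 * t)) (Ioi 0) := by
  intro hint
  have hc : 0 < 1 / (4 * (lam - 1)) := by
    have : 0 < lam - 1 := by linarith
    positivity
  -- eventually `K_λ(t, t) sinh 2t < −1/(4(λ − 1))`
  have hev : ∀ᶠ t in atTop, sphGreenKernel lam t t * Real.sinh (2 * t) < -(1 / (4 * (lam - 1))) :=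
    (tendsto_kernel_diagonal_mul_sinh hlam).eventually (eventually_lt_nhds (by
      have : 0 < lam - 1 := by linarith
      rw [neg_lt_neg_iff]
      apply div_lt_div_of_pos_left one_pos (by positivity)
      linarith))
  obtain ⟨T, hT⟩ := eventually_atTop.mp hev
  set T' := max T 0 with hT'
  have hsub : Ioi T' ⊆ Ioi 0 := Set.Ioi_subset_Ioi (le_max_right _ _)
  have hint' : IntegrableOn (fun t => sphGreenKernel lam t t * Real.sinh (2 * t)) (Ioi T') := hint.mono_set hsub
  -- the constant `1/(4(λ − 1))` would then be integrable on `(T′, ∞)`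
  have hconst : Integrable (fun _ : ℝ => 1 / (4 * (lam - 1))) (volume.restrict (Ioi T')) := by
    refine Integrable.mono hint' aestronglyMeasurable_const ?_
    refine ae_restrict_of_forall_mem measurableSet_Ioi (fun t ht => ?_)
    have ht' : T' < t := ht
    have h := hT t (le_trans (le_max_left T 0) ht'.le)
    rw [Real.norm_eq_abs, Real.norm_eq_abs, abs_of_pos hc, abs_of_neg (by linarith)]
    linarith
  rw [integrable_const_iff] at hconst
  rcases hconst with h0 | hfin
  · exact hc.ne' h0
  · have := @measure_lt_top _ _ (volume.restrict (Ioi T')) hfin Set.univ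
    rw [Measure.restrict_apply_univ, Real.volume_Ioi] at this
    exact lt_irrefl _ this

end measure

end Summit.Ventures.HodgeRepro2.T5SU11KernelDiagonalAsymptotic
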